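import Mathlib.Combinatorics.SetFamily.FourFunctions
import Mathlib.Tactic
import HarnessLib
import HarnessLib.Audit.Tags
import Summits.CriticalPhenomena.PercolationContinuityZ3.Theorems.PercNearOneGluingNoHeavyLowerTailSahiTypeSetDaykinBlock

/-!
# In a crossing configuration, comparable members of the signed family have the same type

Support file (seat `prim-masterthm-p1`, gen 44; `--supports stmt-CriticalPhenomena-4575`).  Theorems only; no `sorry`, standard axioms.
Memo `run/shared/lean/prim/prim-masterthm/FROM-prim-masterthm-p1-g44-MEMBER-FACE.md` §5(a).

SETTING (`…SahiCrossFirstStep`, `…SahiTypeSetDaykinBlock`): `P ⊆ 2^F` labelled by `κ`, CROSSING (any two members meet and do not cover `F`; members with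
different labels are incomparable); the signed family `Z = P ⊔ σP` carries the singleton type-sets `signedTypes F P κ`.
THEOREM ([this work]) `signedTypes_eq_of_subset`: **if `z ⊆ z'` are members of `Z` then they have the same type** — a positive member inside a negative one
would be a disjoint pair (`q ⊆ F \ q'`), a negative inside a positive a covering pair (`F \ q ⊆ q'`), and two comparable members of the same sign have the
same label by cross-label incomparability.  Consequences recorded for the member-face programme: `lcompat_signedTypes_eq_false_of_subset` (comparable
members are never compatible, so a chain inside `Z` contributes no compatible meet among its own members) and `blockTypes_eq_of_chain_fibre` (a `Y`-fibre
of `Z` that is a chain has a SINGLETON block type-set, hence weight `1`: in the deficit `D_Y` of `…SahiTypeSetDaykinBlock` such a fibre of size `k`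
costs exactly `k − 1`).  HONEST FRAMING: elementary structure lemmas; the conjectures remain open. [this work]
-/

namespace Summit.CriticalPhenomena.PercolationContinuityZ3.Theorems.SahiColouredDaykin

open Finset

variable {α : Type*} [DecidableEq α]

section comparable

variable {F : Finset α} {P : Finset (Finset α)} {κ : Finset α → ℕ}

/-- A crossing (pairwise meeting) family is complement-free. [this work] -/
theorem compl_notMem_of_meet (hmeet : ∀ S ∈ P, ∀ T ∈ P, (S ∩ T).Nonempty) : ∀ S ∈ P, F \ S ∉ P := by
  intro S hS hS'
  have hne := hmeet S hS (F \ S) hS'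
  rw [inter_sdiff_self] at hne
  exact Finset.not_nonempty_empty hne

/-- **Comparable members of a crossing signed family have the same type.** [this work] -/
theorem signedTypes_eq_of_subset (hPF : ∀ S ∈ P, S ⊆ F) (hmeet : ∀ S ∈ P, ∀ T ∈ P, (S ∩ T).Nonempty)
    (hcov : ∀ S ∈ P, ∀ T ∈ P, S ∪ T ≠ F) (hinc : ∀ S ∈ P, ∀ T ∈ P, κ S ≠ κ T → ¬ S ⊆ T)
    {z z' : Finset α} (hz : z ∈ P ∪ P.image (fun S => F \ S)) (hz' : z' ∈ P ∪ P.image (fun S => F \ S)) (hzz' : z ⊆ z') :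
    signedTypes F P κ z = signedTypes F P κ z' := by
  have hcf := compl_notMem_of_meet (F := F) hmeet
  rcases mem_union_image_sdiff_iff.1 hz with hzP | ⟨q, hq, rfl⟩ <;>
    rcases mem_union_image_sdiff_iff.1 hz' with hz'P | ⟨q', hq', rfl⟩
  · -- positive ⊆ positive: same label
    have hk : κ z = κ z' := by
      by_contra h; exact hinc z hzP z' hz'P h hzz'
    rw [signedTypes_of_mem hcf hzP, signedTypes_of_mem hcf hz'P, hk]
  · -- positive ⊆ negative: z ∩ q' = ∅
    exfalso
    have hne := hmeet z hzP q' hq'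
    have : z ∩ q' = ∅ := by
      ext t; simp only [mem_inter, notMem_empty, iff_false, not_and]
      intro ht htq; exact (mem_sdiff.1 (hzz' ht)).2 htq
    rw [this] at hne; exact Finset.not_nonempty_empty hne
  · -- negative ⊆ positive: q ∪ z' = F
    exfalso
    apply hcov q hq z' hz'P
    ext t
    constructor
    · intro ht; rcases mem_union.1 ht with h | h
      · exact hPF q hq h
      · exact hPF z' hz'P h
    · intro htF
      by_cases htq : t ∈ q
      · exact mem_union_left _ htq
      · exact mem_union_right _ (hzz' (mem_sdiff.2 ⟨htF, htq⟩))
  · -- negative ⊆ negative: q' ⊆ q, same label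
    have hq'q : q' ⊆ q := by
      intro t ht
      by_contra htq
      have : t ∈ F \ q := mem_sdiff.2 ⟨hPF q' hq' ht, htq⟩
      exact (mem_sdiff.1 (hzz' this)).2 ht
    have hk : κ q' = κ q := by
      by_contra h; exact hinc q' hq' q hq h hq'q
    rw [signedTypes_of_sdiff_mem hPF hcf hq, signedTypes_of_sdiff_mem hPF hcf hq', hk]

/-- Hence comparable members are never compatible: their common type-set is a singleton `{t}` and no type is compatible with itself. [this work] -/
theorem lcompat_signedTypes_eq_false_of_subset (hPF : ∀ S ∈ P, S ⊆ F) (hmeet : ∀ S ∈ P, ∀ T ∈ P, (S ∩ T).Nonempty)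
    (hcov : ∀ S ∈ P, ∀ T ∈ P, S ∪ T ≠ F) (hinc : ∀ S ∈ P, ∀ T ∈ P, κ S ≠ κ T → ¬ S ⊆ T)
    {z z' : Finset α} (hz : z ∈ P ∪ P.image (fun S => F \ S)) (hz' : z' ∈ P ∪ P.image (fun S => F \ S)) (hzz' : z ⊆ z') :
    lcompat (signedTypes F P κ z) (signedTypes F P κ z') = false := by
  have hcf := compl_notMem_of_meet (F := F) hmeet
  rw [← signedTypes_eq_of_subset hPF hmeet hcov hinc hz hz' hzz']
  obtain ⟨t, ht⟩ : ∃ t, signedTypes F P κ z = {t} := by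
    rcases mem_union_image_sdiff_iff.1 hz with hzP | ⟨q, hq, rfl⟩
    · exact ⟨_, signedTypes_of_mem hcf hzP⟩
    · exact ⟨_, signedTypes_of_sdiff_mem hPF hcf hq⟩
  rw [ht, Bool.eq_false_iff]
  intro h
  rw [lcompat_iff] at h
  obtain ⟨a, ha, b, hb, hab⟩ := h
  rw [mem_singleton] at ha hb; subst ha; subst hb
  rw [tcompat_eq_true_iff] at hab
  exact (hab.1 rfl) rfl

/-- **A chain fibre has a singleton block type-set.**  If every member of `Z` with `Y`-trace `u` is comparable with a fixed member `z₀` of that fibre, then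
`blockTypes Z (signedTypes F P κ) Y u = signedTypes F P κ z₀` (so its weight is `1`). [this work] -/
theorem blockTypes_eq_of_chain_fibre (hPF : ∀ S ∈ P, S ⊆ F) (hmeet : ∀ S ∈ P, ∀ T ∈ P, (S ∩ T).Nonempty)
    (hcov : ∀ S ∈ P, ∀ T ∈ P, S ∪ T ≠ F) (hinc : ∀ S ∈ P, ∀ T ∈ P, κ S ≠ κ T → ¬ S ⊆ T) {Y u z₀ : Finset α}
    (hz₀ : z₀ ∈ P ∪ P.image (fun S => F \ S)) (hu : z₀ \ Y = u)
    (hchain : ∀ z ∈ P ∪ P.image (fun S => F \ S), z \ Y = u → z ⊆ z₀ ∨ z₀ ⊆ z) :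
    blockTypes (P ∪ P.image (fun S => F \ S)) (signedTypes F P κ) Y u = signedTypes F P κ z₀ := by
  ext t
  rw [mem_blockTypes]
  constructor
  · rintro ⟨z, hz, hzu, ht⟩
    rcases hchain z hz hzu with h | h
    · rwa [← signedTypes_eq_of_subset hPF hmeet hcov hinc hz hz₀ h]
    · rwa [signedTypes_eq_of_subset hPF hmeet hcov hinc hz₀ hz h]
  · intro ht; exact ⟨z₀, hz₀, hu, ht⟩

end comparable

end Summit.CriticalPhenomena.PercolationContinuityZ3.Theorems.SahiColouredDaykin
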